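import Literature.IUT.HodgeTheaters.InitialThetaDataTorsionMonodromyModel
import HarnessLib

/-!
# [IUTchI] §1 / Def 3.1 (b)(c)(d) / Def 6.1 (v): the GROUP-RING TWO-STEP model `Π_{C_F} := (𝔽_l[E_F[l]] ⋊ E_F[l]) ⋊ (G_F × {±1})`
# — an `E_F[l]`-TWISTED finite shadow of `Π_{C_F}` with `l` CUSPS (NV-L5 row «JOINT-NV-CG (l cusps)», part B1:
# the normal factor, the outer action, the profinite group; definitions)

S. Mochizuki, *Inter-universal Teichmüller theory I*, kurims manuscript (May 2020), §1 p. 37 «`Δ_X̲ ↠ Δ_X̲^{ab} ⊗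
(ℤ/lℤ) ↠ Δ_ε` … a natural exact sequence `0 → I_{ε′} × I_{ε″} → Δ_ε → Δ_E ⊗ (ℤ/lℤ) → 0`», §3 Definition 3.1 (b) p. 61
«`C_F` … the quotient of `X_F` by the unique `F`-involution `−1`», (c) p. 62 «the image of the outer homomorphism
`G_F → GL₂(𝔽_l)` determined by the `l`-torsion points of `E_F` contains the subgroup `SL₂(𝔽_l)`», (d) p. 62 «`X̲_K` of
type `(1, l-tors)` [cf. [EtTh], Definition 2.1]» ([EtTh] Def 2.1 p. 36: «the restricted map `D_x → Q` is trivial …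
the corresponding covering `X̲^log → X^log`» — the cusp of `X` splits into `l` cusps of `X̲`), §6 Definition 6.1 (v)
p. 158 «from the Galois action on `Δ_X^{ab} ⊗ 𝔽_l`» ([IUTchI] §1 p.37, Def 3.1 p.61–62, Def 6.1 (v) p.158) [claim:
Mochizuki2012, status: disputed] (D-0012 claim key; series status DISPUTED — a MODEL of the cell's `π₁`-interface
structures; nothing of the series is asserted; no side taken on [IUTchIII] Cor. 3.12).

## WHY (abc-iut-L5-lead gen 6 RULINGS #68/#71/#73/#74: row «JOINT-NV-CG (l cusps)», owner abc-iut-L5-t8 g7; design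
## memo HOME/staging/L5/L5-t8/g7/STEP0-jointNV-CG.md — the binder SET {CG, hS, M, hA, hI} of the good-place `Λ`
## (p446888) and of the genuine §6 kits (p448457) needs ONE joint witness; two kernel-precise OBSTRUCTIONS rule out the
## existing models: (O1) a PRODUCT ambient `G_F × (finite)` (abc-iut-L5-t1's `ArrowModel`: carries CG/hA) cannot carry
## `M` (`tau_mul` + `tau_surjOn` + `tau_conj` ⇒ `G_F` fixes `E_F[l]` pointwise, Def 3.1 (c)); (O2) an ABELIAN inertia
## factor (this lineage's `regeom`, abc-iut-w4-d077's `regeom₂`: carry M/hI) cannot carry `CG` (`act_decomp` +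
## `eq_of_conj`; `free` + `transitive` ⇒ `#Cusp = l`, `InitialThetaDataTorsionMonodromyModelNoCuspGalois.lean`).
## This file starts the model that passes both: the `E_F[l]`-direction is SEMIDIRECT under `G_F`, and the inertia lives
## in the TRANSLATION MODULE `U := 𝔽_l[E_F[l](F̄)]`, on which `E_F[l]` acts by a genuine shift.)

## WHAT (part B1; parts B2–B6 = `…TorsionCuspModelKLevel/Geometry/Proofs/ModLCuspLaws/Joint.lean`)

* `U := 𝔽_l[T]` (`T := E_F[l](F̄)` = this lineage's `TorsionMonodromyModel.Tors`), as `Multiplicative (T → ZMod l)`,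
  finite, discrete; basis vectors `U.e P`; the TRANSLATION action `transl : T →* MulAut U`, `(P·f)(Q) = f(Q P⁻¹)`;
* `Del := U ⋊[transl] T` — the model's `Δ_X` (finite, discrete; two-step: `[Del, Del] ⊆ U`);
* the OUTER ACTION of `G_F × {±1}` (`GalPM`): on `T` by `act` (= `torsRep σ ∘ (u·)`, the GENUINE mod-`l` Galois
  representation and the sign of the involution), on `U` by `f ↦ ε(u)·(f ∘ act(q)⁻¹)` with the SIGN `ε(u) = u ∈ {±1}`
  (this sign is what makes «`ι` acts on `Δ_E ⊗ ℤ/l` by `−1`», §1 p. 38 l. 1, hold in the model); `outU`, `outDel`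
  (via Mathlib's `SemidirectProduct.congr`), `outer : GalPM →* MulAut Del`;
* `PiC := Del ⋊[outer] GalPM` — **the model `Π_{C_F}`**, topologised along `(left, right)`, a PROFINITE group (the
  action is jointly continuous because it factors through the open kernel of `torsRep`, `isOpen_ker_torsRep`);
  `ext : FundamentalExtension` (`Π_{C_F} ↠ G_F`), `sgn`, `PiX := Ker(sgn)` (= `Π_{X_F}`, normal).  Index/openness of
  `PiX`, the `K`-level data, the cusps and the torsion coordinate `τ` follow in part B2.

HONEST LABEL «[model; `E[l]`-twisted finite shadow `U ⋊ E[l]`; `l` cusps; CG INHABITED (parts B2–B4)]»: `Δ_X` is FINITE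
and synthetic; only `T = E_F[l](F̄)` with its Galois action and sign is the curve's; the class `a^l` of print's `Δ_X̲` is
absent (`a^l = 1` here).  Instances only on this file's own model types.  Model ≠ genuine datum; instantiated ≠ endorsed;
typed ≠ proved; nothing here bears on [IUTchIII] Cor. 3.12.
-/

noncomputable section

namespace Literature.IUT.HodgeTheaters

universe u

namespace TorsionCuspModel

open Literature.AnabelianGeometry.AbsoluteAnabelian Topology TorsionMonodromyModel
open Literature.AnabelianGeometry.EtaleTheta.SettingModel
open scoped WeierstrassCurve.Affine Classical

variable {F : Type u} [Field F] (E : WeierstrassCurve F) (Fbar : Type u) [Field Fbar] [Algebra F Fbar] (l : ℕ)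

/-! ## The inertia module `U := 𝔽_l[E_F[l](F̄)]` with the translation action of `T = E_F[l](F̄)` -/

/-- **`U := 𝔽_l[E_F[l](F̄)]`** — functions `T → ZMod l`, written multiplicatively (the synthetic INERTIA MODULE of the
model: the cusp inertia vectors of `X̲` will be shifted differences of basis vectors); a model type of this file.
[cite: Mochizuki2012, IUTchI §1 p.37] -/
abbrev U : Type u := Multiplicative (Tors E Fbar l → ZMod l)

namespace U

/-- The discrete topology on the inertia module. [folklore] -/
instance instTopologicalSpace : TopologicalSpace (U E Fbar l) := ⊥

/-- The topology is discrete by definition. [folklore] -/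
instance instDiscreteTopology : DiscreteTopology (U E Fbar l) := ⟨rfl⟩

/-- A discrete group is a topological group. [folklore] -/
instance instIsTopologicalGroup : IsTopologicalGroup (U E Fbar l) where
  continuous_mul := continuous_of_discreteTopology
  continuous_inv := continuous_of_discreteTopology

/-- `U` is finite (`T` and `ZMod l` are). [folklore] -/
instance instFinite [E.IsElliptic] [NeZero l] : Finite (U E Fbar l) :=
  Finite.of_equiv (Tors E Fbar l → ZMod l) Multiplicative.ofAdd

variable {E Fbar l}

/-- The basis vector `e_P ∈ 𝔽_l[T]` of `P ∈ T`. [cite: Mochizuki2012, IUTchI §1 p.37] -/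
def e (P : Tors E Fbar l) : U E Fbar l := Multiplicative.ofAdd (Pi.single P 1)

/-- `e_P(Q) = [Q = P]`. [cite: Mochizuki2012, IUTchI §1 p.37] -/
theorem toAdd_e_apply (P Q : Tors E Fbar l) : Multiplicative.toAdd (e P) Q = if Q = P then 1 else 0 := by
  unfold e
  rw [toAdd_ofAdd, Pi.single_apply]

/-- Pointwise multiplication is pointwise addition of functions. [cite: Mochizuki2012, IUTchI Def 3.1 (b)(c) p.61–62] -/
@[simp] theorem toAdd_mul_apply (f g : U E Fbar l) (Q : Tors E Fbar l) :
    Multiplicative.toAdd (f * g) Q = Multiplicative.toAdd f Q + Multiplicative.toAdd g Q := rfl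

/-- [cite: Mochizuki2012, IUTchI Def 3.1 (b)(c) p.61–62] -/
@[simp] theorem toAdd_one_apply (Q : Tors E Fbar l) : Multiplicative.toAdd (1 : U E Fbar l) Q = 0 := rfl

/-- [cite: Mochizuki2012, IUTchI Def 3.1 (b)(c) p.61–62] -/
@[simp] theorem toAdd_inv_apply (f : U E Fbar l) (Q : Tors E Fbar l) :
    Multiplicative.toAdd f⁻¹ Q = -Multiplicative.toAdd f Q := rfl

/-- Two elements of `U` are equal iff their coordinate functions agree. [cite: Mochizuki2012, IUTchI Def 3.1 (b)(c) p.61–62] -/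
theorem ext {f g : U E Fbar l} (h : ∀ Q, Multiplicative.toAdd f Q = Multiplicative.toAdd g Q) : f = g :=
  Multiplicative.toAdd.injective (funext h)

end U

variable {E Fbar l} in
/-- The translation by `P ∈ T` on `U`: `(P·f)(Q) := f(Q P⁻¹)` (so `P·e_Q = e_{QP}`). [cite: Mochizuki2012, IUTchI §1 p.37] -/
def shiftEquiv (P : Tors E Fbar l) : U E Fbar l ≃* U E Fbar l where
  toFun f := Multiplicative.ofAdd fun Q => Multiplicative.toAdd f (Q * P⁻¹)
  invFun f := Multiplicative.ofAdd fun Q => Multiplicative.toAdd f (Q * P)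
  left_inv f := U.ext fun Q => by simp only [toAdd_ofAdd, mul_inv_cancel_right]
  right_inv f := U.ext fun Q => by simp only [toAdd_ofAdd, inv_mul_cancel_right]
  map_mul' f g := U.ext fun Q => rfl

/-- [cite: Mochizuki2012, IUTchI §1 p.37] -/
@[simp] theorem toAdd_shiftEquiv_apply (P : Tors E Fbar l) (f : U E Fbar l) (Q : Tors E Fbar l) :
    Multiplicative.toAdd (shiftEquiv P f) Q = Multiplicative.toAdd f (Q * P⁻¹) := rfl

/-- **The translation action `transl : T →* Aut(U)`** of `E_F[l](F̄)` on `𝔽_l[E_F[l](F̄)]`.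
[cite: Mochizuki2012, IUTchI §1 p.37] -/
def transl : Tors E Fbar l →* MulAut (U E Fbar l) where
  toFun := shiftEquiv
  map_one' := MulEquiv.ext fun f => U.ext fun Q => by
    rw [toAdd_shiftEquiv_apply, inv_one, mul_one, MulAut.one_apply]
  map_mul' P P' := MulEquiv.ext fun f => U.ext fun Q => by
    rw [MulAut.mul_apply, toAdd_shiftEquiv_apply, toAdd_shiftEquiv_apply, toAdd_shiftEquiv_apply, mul_inv_rev,
      mul_comm P'⁻¹ P⁻¹, mul_assoc]

/-- `(transl P f)(Q) = f(Q P⁻¹)`. [cite: Mochizuki2012, IUTchI §1 p.37] -/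
@[simp] theorem toAdd_transl_apply (P : Tors E Fbar l) (f : U E Fbar l) (Q : Tors E Fbar l) :
    Multiplicative.toAdd (transl E Fbar l P f) Q = Multiplicative.toAdd f (Q * P⁻¹) := rfl

/-! ## The model's `Δ_X`: the two-step group `Del := U ⋊ T` -/

/-- **`Del := 𝔽_l[E_F[l]] ⋊ E_F[l]`** — the model's geometric fundamental group `Δ_X` (finite, two-step; a quotient-type
finite shadow of print's free profinite `Δ_X` of rank two); a model type of this file. [cite: Mochizuki2012, IUTchI Def 3.1 (b) p.61] -/
abbrev Del : Type u := U E Fbar l ⋊[transl E Fbar l] Tors E Fbar l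

namespace Del

/-- The discrete topology on the finite geometric factor. [folklore] -/
instance instTopologicalSpace : TopologicalSpace (Del E Fbar l) := ⊥

/-- The topology is discrete by definition. [folklore] -/
instance instDiscreteTopology : DiscreteTopology (Del E Fbar l) := ⟨rfl⟩

/-- A discrete group is a topological group. [folklore] -/
instance instIsTopologicalGroup : IsTopologicalGroup (Del E Fbar l) where
  continuous_mul := continuous_of_discreteTopology
  continuous_inv := continuous_of_discreteTopology

/-- `Del` is finite. [folklore] -/
instance instFinite [E.IsElliptic] [NeZero l] : Finite (Del E Fbar l) :=
  Finite.of_equiv _ SemidirectProduct.equivProd.symm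

end Del

/-! ## The outer action of `G_F × {±1}` on `Del` -/

variable {E Fbar l}

/-- The scalar SIGN `ε(q) := u ∈ {±1} ⊆ 𝔽_l` of `q = (σ, u)`. [cite: Mochizuki2012, IUTchI §1 p.38] -/
def sgnScalar (q : GalPM F Fbar) : ZMod l := ((q.2 : ℤ) : ZMod l)

/-- `ε(q)² = 1`. [cite: Mochizuki2012, IUTchI Def 3.1 (b)(c) p.61–62] -/
theorem sgnScalar_mul_self (q : GalPM F Fbar) : sgnScalar (l := l) q * sgnScalar (l := l) q = 1 := by
  unfold sgnScalar
  rw [← Int.cast_mul, ← Units.val_mul, Int.units_mul_self, Units.val_one, Int.cast_one]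

/-- `ε` is multiplicative. [cite: Mochizuki2012, IUTchI Def 3.1 (b)(c) p.61–62] -/
theorem sgnScalar_mul (q q' : GalPM F Fbar) :
    sgnScalar (l := l) (q * q') = sgnScalar (l := l) q * sgnScalar (l := l) q' := by
  unfold sgnScalar
  rw [Prod.snd_mul, Units.val_mul, Int.cast_mul]

/-- `ε(1) = 1`. [cite: Mochizuki2012, IUTchI Def 3.1 (b)(c) p.61–62] -/
theorem sgnScalar_one : sgnScalar (l := l) (1 : GalPM F Fbar) = 1 := by
  unfold sgnScalar
  rw [Prod.snd_one, Units.val_one, Int.cast_one]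

variable (E l) in
/-- **The action of `q = (σ, u) ∈ G_F × {±1}` on the inertia module**: `(q·f)(Q) := ε(u) · f(act(q)⁻¹ Q)` — the
permutation of the basis induced by the genuine action `act q` on `T = E_F[l](F̄)`, twisted by the sign `ε(u) = u`.
[cite: Mochizuki2012, IUTchI §1 p.38] -/
def outU (q : GalPM F Fbar) : U E Fbar l ≃* U E Fbar l where
  toFun f := Multiplicative.ofAdd fun Q => sgnScalar (l := l) q * Multiplicative.toAdd f ((act F E Fbar l q).symm Q)
  invFun f := Multiplicative.ofAdd fun Q => sgnScalar (l := l) q * Multiplicative.toAdd f (act F E Fbar l q Q)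
  left_inv f := U.ext fun Q => by
    simp only [toAdd_ofAdd, MulEquiv.symm_apply_apply, ← mul_assoc, sgnScalar_mul_self, one_mul]
  right_inv f := U.ext fun Q => by
    simp only [toAdd_ofAdd, MulEquiv.apply_symm_apply, ← mul_assoc, sgnScalar_mul_self, one_mul]
  map_mul' f g := U.ext fun Q => by
    simp only [toAdd_ofAdd, U.toAdd_mul_apply, mul_add]

/-- `(outU q f)(Q) = ε(q) · f(act(q)⁻¹ Q)`. [cite: Mochizuki2012, IUTchI §1 p.38] -/
@[simp] theorem toAdd_outU_apply (q : GalPM F Fbar) (f : U E Fbar l) (Q : Tors E Fbar l) :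
    Multiplicative.toAdd (outU E l q f) Q = sgnScalar (l := l) q * Multiplicative.toAdd f ((act F E Fbar l q).symm Q) :=
  rfl

/-- COMPATIBILITY of the two actions: `q · (P · f) = (act q P) · (q · f)` — the pair `(outU q, act q)` is an automorphism
of `Del = U ⋊ T`. [cite: Mochizuki2012, IUTchI §1 p.37] -/
theorem outU_transl (q : GalPM F Fbar) (P : Tors E Fbar l) :
    (transl E Fbar l P).trans (outU E l q) = (outU E l q).trans (transl E Fbar l (act F E Fbar l q P)) := by
  refine MulEquiv.ext fun f => U.ext fun Q => ?_
  rw [MulEquiv.trans_apply, MulEquiv.trans_apply, toAdd_outU_apply, toAdd_transl_apply, toAdd_transl_apply,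
    toAdd_outU_apply, map_mul, map_inv, MulEquiv.symm_apply_apply]

variable (E l) in
/-- **The action of `q ∈ G_F × {±1}` on `Del = U ⋊ T`** (componentwise `(outU q, act q)`). [cite: Mochizuki2012, IUTchI Def 3.1 (c) p.62] -/
def outDel (q : GalPM F Fbar) : Del E Fbar l ≃* Del E Fbar l :=
  SemidirectProduct.congr (outU E l q) (act F E Fbar l q) (outU_transl q)

/-- [cite: Mochizuki2012, IUTchI Def 3.1 (c) p.62] -/
@[simp] theorem outDel_apply_left (q : GalPM F Fbar) (d : Del E Fbar l) : (outDel E l q d).left = outU E l q d.left := rfl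

/-- [cite: Mochizuki2012, IUTchI Def 3.1 (c) p.62] -/
@[simp] theorem outDel_apply_right (q : GalPM F Fbar) (d : Del E Fbar l) :
    (outDel E l q d).right = act F E Fbar l q d.right := rfl

/-- `outU` is a homomorphism in `q`. [cite: Mochizuki2012, IUTchI Def 3.1 (b)(c) p.61–62] -/
theorem outU_mul (q q' : GalPM F Fbar) : outU E l (q * q') = outU E l q * outU E l q' := by
  refine MulEquiv.ext fun f => U.ext fun Q => ?_
  rw [MulAut.mul_apply, toAdd_outU_apply, toAdd_outU_apply, toAdd_outU_apply, sgnScalar_mul, map_mul, mul_assoc]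
  rfl

/-- `outU 1 = 1`. [cite: Mochizuki2012, IUTchI Def 3.1 (b)(c) p.61–62] -/
theorem outU_one : outU E l (1 : GalPM F Fbar) = 1 := by
  refine MulEquiv.ext fun f => U.ext fun Q => ?_
  rw [toAdd_outU_apply, sgnScalar_one, one_mul, map_one, MulAut.one_apply]
  rfl

variable (F E Fbar l) in
/-- **The outer action `outer : G_F × {±1} →* Aut(Del)`**. [cite: Mochizuki2012, IUTchI Def 3.1 (c) p.62] -/
def outer : GalPM F Fbar →* MulAut (Del E Fbar l) where
  toFun := outDel E l
  map_one' := MulEquiv.ext fun d => SemidirectProduct.ext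
    (by rw [outDel_apply_left, outU_one, MulAut.one_apply, MulAut.one_apply])
    (by rw [outDel_apply_right, map_one, MulAut.one_apply, MulAut.one_apply])
  map_mul' q q' := MulEquiv.ext fun d => SemidirectProduct.ext
    (by rw [outDel_apply_left, outU_mul, MulAut.mul_apply, MulAut.mul_apply, outDel_apply_left, outDel_apply_left])
    (by rw [outDel_apply_right, map_mul, MulAut.mul_apply, MulAut.mul_apply, outDel_apply_right, outDel_apply_right])

/-- [cite: Mochizuki2012, IUTchI Def 3.1 (c) p.62] -/
@[simp] theorem outer_apply_left (q : GalPM F Fbar) (d : Del E Fbar l) :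
    (outer F E Fbar l q d).left = outU E l q d.left := rfl

/-- [cite: Mochizuki2012, IUTchI Def 3.1 (c) p.62] -/
@[simp] theorem outer_apply_right (q : GalPM F Fbar) (d : Del E Fbar l) :
    (outer F E Fbar l q d).right = act F E Fbar l q d.right := rfl

/-- An element `(σ, 1)` with `σ` FIXING the `l`-torsion acts trivially on `Del` (this is why `G_K × (Del ⋊ {±1})` embeds
as a PRODUCT at the `K`-level, Def 3.1 (c)(d)). [cite: Mochizuki2012, IUTchI Def 3.1 (c) p.62] -/
theorem outer_eq_one_of_fixesTorsion {σ : Fbar ≃ₐ[F] Fbar} (h : FixesTorsion E l σ) :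
    outer F E Fbar l (σ, 1) = 1 := by
  have hact : act F E Fbar l (σ, 1) = 1 := by
    rw [act, MonoidHom.noncommCoprod_apply, map_one, mul_one]
    exact (mem_ker_torsRep_iff E Fbar l σ).mpr h
  refine MulEquiv.ext fun d => SemidirectProduct.ext ?_ ?_
  · refine U.ext fun Q => ?_
    rw [outer_apply_left, toAdd_outU_apply, hact, MulAut.one_apply]
    show ((((1 : ℤˣ) : ℤ) : ZMod l)) * _ = _
    rw [Units.val_one, Int.cast_one, one_mul]
    rfl
  · rw [outer_apply_right, hact, MulAut.one_apply, MulAut.one_apply]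

/-! ## `Π_{C_F} := Del ⋊ (G_F × {±1})` as a profinite group -/

variable (F E Fbar l)

/-- **The model `Π_{C_F} := (𝔽_l[E_F[l]] ⋊ E_F[l]) ⋊ (G_F × {±1})`**; a model type of this file.
[cite: Mochizuki2012, IUTchI Def 3.1 (b) p.61] -/
abbrev PiC : Type u := Del E Fbar l ⋊[outer F E Fbar l] GalPM F Fbar

namespace PiC

/-- The topology of `Π_{C_F}`: induced along `g ↦ (g.left, g.right)`. [folklore] -/
instance instTopologicalSpace : TopologicalSpace (PiC F E Fbar l) :=
  TopologicalSpace.induced (fun g : PiC F E Fbar l => (g.left, g.right)) inferInstance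

/-- `g ↦ (g.left, g.right)` is inducing (by definition). [cite: Mochizuki2012, IUTchI Def 3.1 (b)(c) p.61–62] -/
theorem isInducing : IsInducing fun g : PiC F E Fbar l => (g.left, g.right) := ⟨rfl⟩

end PiC

variable {F E Fbar l} in
/-- A homomorphism into the automorphisms of a DISCRETE group with OPEN kernel gives a jointly continuous action.
[folklore] -/
private theorem cusp_continuous_action_of_isOpen_ker {G N : Type*} [Group G] [TopologicalSpace G]
    [IsTopologicalGroup G] [Group N] [TopologicalSpace N] [DiscreteTopology N] (ρ : G →* MulAut N)
    (hρ : IsOpen (ρ.ker : Set G)) : Continuous fun q : G × N => ρ q.1 q.2 := by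
  refine continuous_def.2 fun S _ => ?_
  rw [isOpen_iff_mem_nhds]
  rintro ⟨g, n⟩ hq
  have hV : IsOpen ((fun q : G × N => (g⁻¹ * q.1, q.2)) ⁻¹' ((ρ.ker : Set G) ×ˢ {n})) :=
    (hρ.prod (isOpen_discrete _)).preimage ((continuous_const.mul continuous_fst).prodMk continuous_snd)
  refine Filter.mem_of_superset (hV.mem_nhds ?_) ?_
  · show (g⁻¹ * g, n) ∈ (ρ.ker : Set G) ×ˢ ({n} : Set N)
    rw [inv_mul_cancel]
    exact ⟨ρ.ker.one_mem, rfl⟩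
  · rintro ⟨g', n'⟩ ⟨hg', hn'⟩
    have hn'' : n' = n := hn'
    subst hn''
    have hk : ρ (g⁻¹ * g') = 1 := hg'
    show ρ g' n' ∈ S
    have : ρ g' n' = ρ g n' := by
      conv_lhs => rw [← mul_inv_cancel_left g g', map_mul, hk, mul_one]
    rw [this]
    exact hq

/-- The outer action is jointly continuous (`Ker ⊇ Ker ρ × 1` is open: `isOpen_ker_torsRep`).
[cite: Mochizuki2012, IUTchI Def 3.1 (c) p.62] -/
theorem continuous_outer [Algebra.IsAlgebraic F Fbar] [E.IsElliptic] [NeZero l] :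
    Continuous fun q : GalPM F Fbar × Del E Fbar l => outer F E Fbar l q.1 q.2 := by
  refine cusp_continuous_action_of_isOpen_ker (outer F E Fbar l) ?_
  refine Subgroup.isOpen_mono (H₁ := (torsRep E Fbar l).ker.prod ⊥) ?_ ?_
  · rintro ⟨σ, u⟩ h
    rw [Subgroup.mem_prod, Subgroup.mem_bot] at h
    obtain ⟨hσ, hu⟩ := h
    dsimp only at hσ hu
    subst hu
    rw [MonoidHom.mem_ker]
    exact outer_eq_one_of_fixesTorsion ((mem_ker_torsRep_iff E Fbar l σ).mp hσ)
  · rw [Subgroup.coe_prod, Subgroup.coe_bot]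
    exact (isOpen_ker_torsRep E Fbar l).prod (isOpen_discrete _)

namespace PiC

/-- `Π_{C_F}` is a topological group (jointly continuous action). [folklore] -/
instance instIsTopologicalGroup [IsGalois F Fbar] [E.IsElliptic] [NeZero l] : IsTopologicalGroup (PiC F E Fbar l) :=
  Semidirect.isTopologicalGroup_of_continuous_action (isInducing F E Fbar l) (continuous_outer F E Fbar l)

/-- `Π_{C_F}` is compact (`Del` finite, `G_F` profinite). [folklore] -/
instance instCompactSpace [IsGalois F Fbar] [E.IsElliptic] [NeZero l] : CompactSpace (PiC F E Fbar l) :=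
  Semidirect.compactSpace_of (isInducing F E Fbar l)

/-- `Π_{C_F}` is totally disconnected. [folklore] -/
instance instTotallyDisconnectedSpace [IsGalois F Fbar] : TotallyDisconnectedSpace (PiC F E Fbar l) :=
  Semidirect.totallyDisconnectedSpace_of (isInducing F E Fbar l)

end PiC

section Ext

variable [IsGalois F Fbar] [E.IsElliptic] [NeZero l]

/-- **`Π_{C_F} ↠ G_F`** of the model as a `FundamentalExtension` (abc-iut-L4-t1): `⟨d, (σ, u)⟩ ↦ σ`, so
`Δ_C = Del ⋊ (1 × {±1})`. [cite: Mochizuki2012, IUTchI Def 3.1 (b) p.61] -/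
def ext : FundamentalExtension.{u} where
  arith := ProfiniteGrp.of (PiC F E Fbar l)
  gal := ProfiniteGrp.of (Fbar ≃ₐ[F] Fbar)
  aug := (ContinuousMonoidHom.fst (Fbar ≃ₐ[F] Fbar) ℤˣ).comp (Semidirect.rightHomCont (PiC.isInducing F E Fbar l))
  aug_surjective σ := ⟨SemidirectProduct.inr (σ, 1), rfl⟩

/-- The augmentation of the model: `aug ⟨d, (σ, u)⟩ = σ`. [cite: Mochizuki2012, IUTchI Def 3.1 (b) p.61] -/
@[simp] theorem ext_aug_apply (g : PiC F E Fbar l) : (ext F E Fbar l).aug g = g.right.1 := rfl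

/-- `Δ_C` of the model: `g ∈ Δ_C ↔ g.right.1 = 1`. [cite: Mochizuki2012, IUTchI Def 3.1 (b) p.61] -/
theorem mem_geom_ext_iff (g : PiC F E Fbar l) :
    (g : (ext F E Fbar l).arith) ∈ (ext F E Fbar l).geom ↔ g.right.1 = 1 :=
  (ext F E Fbar l).mem_geom

end Ext

/-- `sgn : Π_{C_F} → Gal(X_F/C_F) = {±1}`, `⟨d, (σ, u)⟩ ↦ u`. [cite: Mochizuki2012, IUTchI Def 3.1 (b) p.61] -/
def sgn : PiC F E Fbar l →* ℤˣ := (MonoidHom.snd (Fbar ≃ₐ[F] Fbar) ℤˣ).comp SemidirectProduct.rightHom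

/-- [cite: Mochizuki2012, IUTchI Def 3.1 (b) p.61] -/
@[simp] theorem sgn_apply (g : PiC F E Fbar l) : sgn F E Fbar l g = g.right.2 := rfl

/-- `sgn` is surjective. [cite: Mochizuki2012, IUTchI Def 3.1 (b) p.61] -/
theorem sgn_surjective : Function.Surjective (sgn F E Fbar l) := fun u => ⟨SemidirectProduct.inr (1, u), rfl⟩

/-- **`Π_{X_F} := Ker(sgn) = Del ⋊ (G_F × 1)`** (`X_F → C_F` the quotient by `±1`). [cite: Mochizuki2012, IUTchI Def 3.1 (b) p.61] -/
def PiX : Subgroup (PiC F E Fbar l) := (sgn F E Fbar l).ker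

/-- [cite: Mochizuki2012, IUTchI Def 3.1 (b) p.61] -/
theorem mem_PiX_iff (g : PiC F E Fbar l) : g ∈ PiX F E Fbar l ↔ g.right.2 = 1 := Iff.rfl

/-- `Π_{X_F}` is normal. [cite: Mochizuki2012, IUTchI Def 3.1 (b) p.61] -/
instance PiX_normal : (PiX F E Fbar l).Normal := inferInstanceAs (sgn F E Fbar l).ker.Normal

end TorsionCuspModel

end Literature.IUT.HodgeTheaters

end
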